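import Summits.BirchSwinnertonDyer.BirchSwinnertonDyer.Theorems.Rank2Observatory2DescPIDCert
import Mathlib.RingTheory.Ideal.Int
import HarnessLib

/-!
# BirchSwinnertonDyer — rank ≥ 2 observatory: class-number-one certificates for cubic fields, general Minkowski bound

HONEST FRAMING: per-curve certified theorems and census instruments; no claim on BSD in rank ≥ 2.

Generic file of the KERNEL-2DESC instrument (design `b2b-bsdr2-cert-3/KERNEL-2DESC.md` §8 S7b, §9e),
extending `Rank2Observatory2DescPIDCert` (`|Δ| ≤ 199`, primes `2`, `3`) to ANY bound: for a cubic field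
`K = ℚ(θ)` with `64·|Δ(F)| < 799·b²` the Minkowski constant is `< b` (`(8/(9π))√|d_K| < b`, using
`799 < 81π²`), so `𝓞 K` is a PID as soon as every prime ideal of norm `< b` is principal. A prime ideal
`I` lies over the rational prime `p = absNorm (I ∩ ℤ)` (`Nat.absNorm_under_prime`), `(p) = I·J`, and
`p³ = N(I)·N(J)` leaves three cases: `N(I) = p` (principal by the degree-one certificate
`isPrincipal_of_absNorm_prime`: every `ψ : 𝓞 K → ℤ/p` kills a prime element), `N(I) = p²` (then
`N(J) = p`, so `J = (g)` by the same certificate, `p = g·q` and `I = (q)` by cancellation), `N(I) = p³`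
(`J = 𝓞 K`, `I = (p)`). Hence the certificate is: for every prime `p < b` and every ring map
`ψ : 𝓞 K → ℤ/p`, a prime element in `ker ψ` — degree-two and inert primes need nothing extra.
Sorry-free; axioms `propext`, `Classical.choice`, `Quot.sound`.
[cite: Marcus2018, Ch. 5, Cor. 2 of Thm. 37 and the discussion after Thm. 37] [cite: Marcus2018, Ch. 3, Thm. 22]
-/

-- single-conjunct summit: `Summit.BirchSwinnertonDyer.BirchSwinnertonDyer.…` repeats the name by design
set_option linter.dupNamespace false

noncomputable section

open scoped Classical NumberField Real nonZeroDivisors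

open Literature.NumberTheory.NumberFields Polynomial Module NumberField NumberField.InfinitePlace Ideal Nat

namespace Summit.BirchSwinnertonDyer.BirchSwinnertonDyer.Rank2Observatory.TwoDescCubic

variable {K : Type*} [Field K] [NumberField K] {A B C : ℤ} {θ : K}

/-- `799 ≤ 81π²` (from `π > 3.1415`). [folklore] -/
theorem bound_799_le : (799 : ℝ) ≤ 81 * π ^ 2 := by
  nlinarith [Real.pi_gt_d4, Real.pi_pos]

/-- **Minkowski constant of a cubic field is `< b` when `64·|d_K| < 799·b²`**:
`(4/π)^{r₂} · (3!/3³) · √|d_K| ≤ (8/(9π))√|d_K| < b`. [cite: Marcus2018, Ch. 5, Cor. 2 of Thm. 37] -/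
theorem minkowskiBound_lt (h3 : finrank ℚ K = 3) {b : ℕ} (hd : 64 * |discr K| < 799 * (b : ℤ) ^ 2) :
    (4 / π) ^ nrComplexPlaces K *
      ((finrank ℚ K)! / (finrank ℚ K) ^ (finrank ℚ K) * √|discr K|) < b := by
  have hc : nrComplexPlaces K ≤ 1 := nrComplexPlaces_le_one h3
  have h1 : (1 : ℝ) ≤ 4 / π := by
    rw [le_div_iff₀ Real.pi_pos]; linarith [Real.pi_le_four]
  have hX : (4 / π) ^ nrComplexPlaces K ≤ 4 / π := by
    calc (4 / π) ^ nrComplexPlaces K ≤ (4 / π) ^ 1 := pow_le_pow_right₀ h1 hc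
      _ = 4 / π := pow_one _
  have hX0 : (0 : ℝ) ≤ (4 / π) ^ nrComplexPlaces K := by positivity
  set s : ℝ := √|((discr K : ℤ) : ℝ)| with hs_def
  have hs0 : 0 ≤ s := Real.sqrt_nonneg _
  have hs2 : s ^ 2 = |((discr K : ℤ) : ℝ)| := Real.sq_sqrt (abs_nonneg _)
  have hdR : 64 * |((discr K : ℤ) : ℝ)| < 799 * (b : ℝ) ^ 2 := by
    rw [← Int.cast_abs]; exact_mod_cast hd
  have hb0 : (0 : ℝ) ≤ 9 * π * b := by positivity
  have hsq : (8 * s) ^ 2 < (9 * π * b) ^ 2 := by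
    have hπ := bound_799_le
    have hb2 : (0 : ℝ) ≤ (b : ℝ) ^ 2 := sq_nonneg _
    nlinarith [hs2, hdR, mul_le_mul_of_nonneg_right hπ hb2]
  have hkey : 8 * s < 9 * π * b := lt_of_pow_lt_pow_left₀ 2 hb0 hsq
  rw [h3]
  have hY : ((3 : ℕ)! : ℝ) / ((3 : ℕ) : ℝ) ^ (3 : ℕ) = 2 / 9 := by norm_num [Nat.factorial]
  rw [hY]
  have hπ0 := Real.pi_pos
  calc (4 / π) ^ nrComplexPlaces K * (2 / 9 * s) ≤ 4 / π * (2 / 9 * s) :=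
        mul_le_mul_of_nonneg_right hX (by positivity)
    _ = 8 * s / (9 * π) := by field_simp; ring
    _ < b := by rw [div_lt_iff₀ (by positivity)]; linarith [hkey]

/-- **The three cases for a prime ideal of a cubic ring of integers**: with `p` the prime under `I`,
`(p) = I·J` for some `J` and `absNorm I = p`, or `absNorm I = p²` with `absNorm J = p`, or `I = (p)`.
[cite: Marcus2018, Ch. 3, Thm. 21] -/
theorem exists_under_cases (h3 : finrank ℚ K = 3) {I : Ideal (𝓞 K)} (hI : I.IsPrime) (hI0 : I ≠ ⊥) :
    ∃ p : ℕ, p.Prime ∧ p ≤ absNorm I ∧ ∃ J : Ideal (𝓞 K), span {(p : 𝓞 K)} = I * J ∧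
      (absNorm I = p ∨ (absNorm I = p ^ 2 ∧ absNorm J = p) ∨ (absNorm I = p ^ 3 ∧ J = ⊤)) := by
  haveI : NeZero I := ⟨hI0⟩
  haveI := hI
  set p : ℕ := absNorm (under ℤ I) with hp_def
  have hp : p.Prime := Nat.absNorm_under_prime I
  have hpI : (p : 𝓞 K) ∈ I := Int.absNorm_under_mem I
  obtain ⟨J, hJ⟩ : I ∣ span {(p : 𝓞 K)} :=
    Ideal.dvd_iff_le.mpr ((Ideal.span_singleton_le_iff_mem _).mpr hpI)
  have hNp : absNorm (span {(p : 𝓞 K)}) = p ^ 3 := by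
    rw [absNorm_span_singleton, Algebra.norm_natCast, RingOfIntegers.rank, h3]
    simp [Int.natAbs_pow]
  have hmul : p ^ 3 = absNorm I * absNorm J := by rw [← hNp, hJ, map_mul]
  obtain ⟨k, hk, hnk⟩ := (Nat.dvd_prime_pow hp).mp ⟨_, hmul⟩
  have h1 : absNorm I ≠ 1 := fun h => hI.ne_top (absNorm_eq_one_iff.mp h)
  have hp0 : p ≠ 0 := hp.ne_zero
  refine ⟨p, hp, ?_, J, hJ, ?_⟩
  · rw [hnk]
    interval_cases k
    · exact absurd (by simpa using hnk) h1
    all_goals exact Nat.le_self_pow (by norm_num) p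
  interval_cases k
  · exact absurd (by simpa using hnk) h1
  · exact Or.inl (by simpa using hnk)
  · refine Or.inr (Or.inl ⟨hnk, ?_⟩)
    have : p ^ 2 * p = p ^ 2 * absNorm J := by rw [← pow_succ, hmul, hnk]
    exact (mul_left_cancel₀ (pow_ne_zero 2 hp0) this).symm
  · refine Or.inr (Or.inr ⟨hnk, ?_⟩)
    have h := hmul
    rw [hnk] at h
    exact absNorm_eq_one_iff.mp (mul_left_cancel₀ (pow_ne_zero 3 hp0) (h.symm.trans (mul_one _).symm))

/-- **Degree-two primes come for free**: if `(p) = I·J` with `absNorm J = p` and the degree-one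
certificate holds at `p`, then `I` is principal (`J = (g)`, `p = g q`, cancel `(g)`).
[cite: Marcus2018, Ch. 3, Thm. 22] -/
theorem isPrincipal_of_cofactor {I J : Ideal (𝓞 K)} {p : ℕ} (hp : p.Prime)
    (hJ : span {(p : 𝓞 K)} = I * J) (hNJ : absNorm J = p)
    (hcert : ∀ ψ : 𝓞 K →+* ZMod p, ∃ e : 𝓞 K, ψ e = 0 ∧ Prime e) :
    Submodule.IsPrincipal I := by
  have hJpr : J.IsPrime := isPrime_of_irreducible_absNorm (hNJ ▸ hp)
  obtain ⟨⟨g, hg⟩⟩ := isPrincipal_of_absNorm_prime hJpr hp hNJ hcert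
  rw [Ideal.submodule_span_eq] at hg
  have hg0 : g ≠ 0 := by
    rintro rfl
    rw [hg, Set.singleton_zero, span_zero, absNorm_bot] at hNJ
    exact hp.ne_zero hNJ.symm
  have hpg : (p : 𝓞 K) ∈ span {g} := by
    have : (p : 𝓞 K) ∈ I * J := hJ ▸ mem_span_singleton_self _
    rw [hg] at this
    exact Ideal.mul_le_left this
  obtain ⟨q, hq⟩ := mem_span_singleton'.mp hpg
  -- `(p) = (q)·(g)` and `(p) = I·(g)`, cancel `(g)`
  have h1 : I * span {g} = span {q} * span {g} := by
    rw [span_singleton_mul_span_singleton, hq, ← hg]; exact hJ.symm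
  have hsg : span ({g} : Set (𝓞 K)) ≠ 0 := by
    simpa [Ideal.zero_eq_bot, span_singleton_eq_bot] using hg0
  exact ⟨⟨q, by rw [mul_right_cancel₀ hsg h1, Ideal.submodule_span_eq]⟩⟩

/-- **Class number one by degree-one certificates below the Minkowski bound** for a cubic field
`K = ℚ(θ)`, `F(θ) = 0`, `64·|Δ(F)| < 799·b²`: if for every prime `p < b` every ring map
`𝓞 K → ℤ/p` kills some prime element, then `𝓞 K` is a PID. [cite: Marcus2018, Ch. 5, Cor. 2 of Thm. 37] -/
theorem isPrincipalIdealRing_of_cert_lt (hirr : Irreducible (MonicCubic.polyQ A B C))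
    (hθ : aeval θ (MonicCubic.poly A B C) = 0) (h3 : finrank ℚ K = 3) {b : ℕ}
    (hd : 64 * |MonicCubic.disc A B C| < 799 * (b : ℤ) ^ 2)
    (hcert : ∀ p : ℕ, p < b → p.Prime → ∀ ψ : 𝓞 K →+* ZMod p, ∃ e : 𝓞 K, ψ e = 0 ∧ Prime e) :
    IsPrincipalIdealRing (𝓞 K) := by
  have hdK : 64 * |discr K| < 799 * (b : ℤ) ^ 2 :=
    lt_of_le_of_lt (by linarith [abs_discr_le_abs_disc hirr hθ h3]) hd
  have hM := minkowskiBound_lt h3 hdK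
  refine RingOfIntegers.isPrincipalIdealRing_of_isPrincipal_of_norm_le_of_isPrime (fun I hI hIN => ?_)
  have hlt : absNorm (I : Ideal (𝓞 K)) < b := by
    have : (absNorm (I : Ideal (𝓞 K)) : ℝ) < (b : ℕ) := lt_of_le_of_lt hIN hM
    exact_mod_cast this
  have hI0 : (I : Ideal (𝓞 K)) ≠ ⊥ := nonZeroDivisors.coe_ne_zero I
  obtain ⟨p, hp, hple, J, hJ, hcases⟩ := exists_under_cases h3 hI hI0
  have hpb : p < b := lt_of_le_of_lt hple hlt
  rcases hcases with hN | ⟨-, hNJ⟩ | ⟨-, hJT⟩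
  · exact isPrincipal_of_absNorm_prime hI hp hN (hcert p hpb hp)
  · exact isPrincipal_of_cofactor hp hJ hNJ (hcert p hpb hp)
  · rw [hJT, Ideal.mul_top] at hJ
    exact ⟨⟨p, by rw [← hJ, Ideal.submodule_span_eq]⟩⟩

end Summit.BirchSwinnertonDyer.BirchSwinnertonDyer.Rank2Observatory.TwoDescCubic

end
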